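import Summits.AtomisticToContinuum.Crystallization.Theorems.DisclinationRationBarlowLiouvilleStubPriceTransfer
import Summits.AtomisticToContinuum.Crystallization.Theorems.HullExactificationCascadeHullDefectDensityZero

/-!
# Crux `BarlowLiouville` (stmt-AtomisticToContinuum-15801), line `Sketch` — the price chain WITH MESOSCOPIC SLACK

Rev 4 of the lead skeleton `DisclinationRationBarlowLiouville` weakens the kernel (the cell-scale tube price
inequality) by a mesoscopic slack `θ · #(X ∩ B̄_L(ctr))` with the quantifier order `∃ c > 0 ∀ θ > 0 ∃ C`
— EXACTLY the shape of the coercivity interface `PrestressSplitKorn.SplitCoercivity` of the sibling crux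
`DefectFreeCrystallizes` (stmt-13603, registered stub S4 of line `prestress-split-korn`), so that the kernel can be
supplied by that engine. This file threads the slack through the two bookkeeping steps of the chain:

* `slack_transfer_explicit` — the landed counting transfer `pt_transfer` (cells → patches) with its constants made
  EXPLICIT (`c ↦ c / (2r/δ+1)³`, `C ↦ C + c·C_{δ,r}/(2r/δ+1)³`), so that a charge chosen BEFORE the slack stays
  chosen before the slack;
* `slack_transfer` — `∃ c ∀ θ ∃ C` price at cell scale ⇒ `∃ c ∀ θ ∃ C` price at patch scale (the slack term rides
  inside the abstract right-hand side `exc`);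
* `ncard_ball_le_cube` — `#(X ∩ B̄_L(ctr)) ≤ (2/δ + 1)³ (L + 1)³` for `L ≥ 0` (the slack is a volume term);
* `density_of_priceSlack` — price with slack + bulk bound + `ℓ ≤ e` ⇒ density zero of bad points (real bookkeeping:
  `θ₁ := c θ/(32(K+1))`, `ε := c θ/4`).
No definitions. [folklore] throughout.
-/

noncomputable section

namespace Summit.AtomisticToContinuum.Crystallization.Theorems.DisclinationRationBarlowLiouville

open scoped BigOperators
open Metric Literature.MathematicalPhysics.StatisticalMechanics
open Summit.AtomisticToContinuum.Crystallization.Theorems.HullBulkOptimal (ncard_ball_le)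
-- `E3 = EuclideanSpace ℝ (Fin 3)`: the reducible library abbreviation.
open Summit.AtomisticToContinuum.Crystallization.Theorems.ChargedEnergyGapNegative (E3)

/-! ## Transfer with explicit constants -/

/-- **Counting transfer, explicit constants.** In a `δ`-separated `X`, if good cells on `B̄_r(y)` force a good
patch at `y` (`H1`) and the cell price holds with charge `c₂ > 0` and boundary constant `C₂` against an arbitrary
right-hand side `exc ctr L` (`H2`), then the patch price holds with charge `c₂ / N` and boundary constant
`C₂ + c₂ C_s / N`, `N = (2r/δ + 1)³`, `C_s = 24(r+δ)(1+δ)²/δ³ + (2(r+δ)/δ)³` — verbatim the landed `pt_transfer`,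
constants exposed. [folklore] -/
theorem slack_transfer_explicit {δ : ℝ} (hδ : 0 < δ) {X : Set E3}
    (hsep : ∀ y ∈ X, ∀ z ∈ X, y ≠ z → δ ≤ dist y z) {r : ℝ} (hr : 0 ≤ r)
    {cell patch : E3 → Prop} {exc : E3 → ℝ → ℝ}
    (H1 : ∀ y ∈ X, (∀ y' ∈ X, dist y' y ≤ r → cell y') → patch y)
    {c₂ : ℝ} (hc₂ : 0 < c₂) {C₂ : ℝ}
    (H2 : ∀ (ctr : E3) (L : ℝ),
      c₂ * (({y : E3 | y ∈ X ∧ dist y ctr ≤ L ∧ ¬ cell y} : Set E3).ncard : ℝ)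
        - C₂ * (L + 1) ^ 2 ≤ exc ctr L) :
    ∀ (ctr : E3) (L : ℝ),
      c₂ / (2 * r / δ + 1) ^ 3 * (({y : E3 | y ∈ X ∧ dist y ctr ≤ L ∧ ¬ patch y} : Set E3).ncard : ℝ)
        - (C₂ + c₂ * (24 * (r + δ) * (1 + δ) ^ 2 / δ ^ 3 + (2 * (r + δ) / δ) ^ 3) / (2 * r / δ + 1) ^ 3)
          * (L + 1) ^ 2 ≤ exc ctr L := by
  intro ctr L
  set N : ℝ := (2 * r / δ + 1) ^ 3 with hN
  set Cs : ℝ := 24 * (r + δ) * (1 + δ) ^ 2 / δ ^ 3 + (2 * (r + δ) / δ) ^ 3 with hCs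
  have hNpos : 0 < N := by positivity
  have hCs0 : 0 ≤ Cs := by positivity
  set Pbad : Set E3 := {y : E3 | y ∈ X ∧ dist y ctr ≤ L ∧ ¬ patch y} with hPbad
  set Qbad : Set E3 := {y : E3 | y ∈ X ∧ dist y ctr ≤ L ∧ ¬ cell y} with hQbad
  set Pin : Set E3 := {y : E3 | y ∈ X ∧ dist y ctr ≤ L - r ∧ ¬ patch y} with hPin
  set A : Set E3 := {y : E3 | y ∈ X ∧ L - r < dist y ctr ∧ dist y ctr ≤ L} with hA
  have hcover : Pbad ⊆ Pin ∪ A := by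
    intro y hy
    by_cases h : dist y ctr ≤ L - r
    · exact Or.inl ⟨hy.1, h, hy.2.2⟩
    · exact Or.inr ⟨hy.1, not_le.1 h, hy.2.1⟩
  have hfinPin : Pin.Finite :=
    finite_of_forall_le_dist_of_subset_closedBall hδ
      (fun p hp q hq hpq => hsep p hp.1 q hq.1 hpq) (c := ctr) (R := L - r)
      (fun p hp => mem_closedBall.2 hp.2.1)
  have hfinA : A.Finite :=
    finite_of_forall_le_dist_of_subset_closedBall hδ
      (fun p hp q hq hpq => hsep p hp.1 q hq.1 hpq) (c := ctr) (R := L)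
      (fun p hp => mem_closedBall.2 hp.2.2)
  have hfinQ : Qbad.Finite :=
    finite_of_forall_le_dist_of_subset_closedBall hδ
      (fun p hp q hq hpq => hsep p hp.1 q hq.1 hpq) (c := ctr) (R := L)
      (fun p hp => mem_closedBall.2 hp.2.1)
  have h1 : (Pbad.ncard : ℝ) ≤ (Pin.ncard : ℝ) + (A.ncard : ℝ) := by
    have := (Set.ncard_le_ncard hcover (hfinPin.union hfinA)).trans (Set.ncard_union_le Pin A)
    exact_mod_cast this
  have h2 : (Pin.ncard : ℝ) ≤ N * (Qbad.ncard : ℝ) := by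
    refine pt_ncard_le_mul_of_cover hδ hsep hr hfinQ (fun y hy => hy.1) fun y hy => ?_
    by_contra hcon
    push Not at hcon
    refine hy.2.2 (H1 y hy.1 fun y' hy' hd => ?_)
    by_contra hcell
    have hy'Q : y' ∈ Qbad := by
      refine ⟨hy', ?_, hcell⟩
      linarith [dist_triangle y' y ctr, hy.2.1]
    have := hcon y' hy'Q
    rw [dist_comm] at hd
    linarith
  have h3 : (A.ncard : ℝ) ≤ Cs * (L + 1) ^ 2 := pt_ncard_annulus_le hδ hsep hr ctr L
  have h4 := H2 ctr L
  have h5 : c₂ / N * (Pbad.ncard : ℝ) ≤ c₂ * (Qbad.ncard : ℝ) + c₂ * Cs / N * (L + 1) ^ 2 := by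
    have hP : (Pbad.ncard : ℝ) ≤ N * (Qbad.ncard : ℝ) + Cs * (L + 1) ^ 2 := by linarith
    calc c₂ / N * (Pbad.ncard : ℝ) ≤ c₂ / N * (N * (Qbad.ncard : ℝ) + Cs * (L + 1) ^ 2) :=
          mul_le_mul_of_nonneg_left hP (div_pos hc₂ hNpos).le
      _ = c₂ * (Qbad.ncard : ℝ) + c₂ * Cs / N * (L + 1) ^ 2 := by
          field_simp
  have h6 : (C₂ + c₂ * Cs / N) * (L + 1) ^ 2 = C₂ * (L + 1) ^ 2 + c₂ * Cs / N * (L + 1) ^ 2 := by ring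
  rw [h6]
  linarith

/-- **Transfer of a price WITH SLACK** (cells → patches): if good cells on `B̄_r(y)` force a good patch at `y`, a
cell-scale price of shape `∃ c > 0 ∀ θ > 0 ∃ C ∀ ctr L, c·#cellbad − C(L+1)² − θ·n(ctr, L) ≤ exc ctr L` gives the
patch-scale price of the same shape (the charge is divided by `(2r/δ+1)³`, chosen before `θ`). [folklore] -/
theorem slack_transfer {δ : ℝ} (hδ : 0 < δ) {X : Set E3}
    (hsep : ∀ y ∈ X, ∀ z ∈ X, y ≠ z → δ ≤ dist y z) {r : ℝ} (hr : 0 ≤ r)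
    {cell patch : E3 → Prop} {exc n : E3 → ℝ → ℝ}
    (H1 : ∀ y ∈ X, (∀ y' ∈ X, dist y' y ≤ r → cell y') → patch y)
    (H2 : ∃ c : ℝ, 0 < c ∧ ∀ θ : ℝ, 0 < θ → ∃ C : ℝ, ∀ (ctr : E3) (L : ℝ),
      c * (({y : E3 | y ∈ X ∧ dist y ctr ≤ L ∧ ¬ cell y} : Set E3).ncard : ℝ)
        - C * (L + 1) ^ 2 - θ * n ctr L ≤ exc ctr L) :
    ∃ c : ℝ, 0 < c ∧ ∀ θ : ℝ, 0 < θ → ∃ C : ℝ, ∀ (ctr : E3) (L : ℝ),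
      c * (({y : E3 | y ∈ X ∧ dist y ctr ≤ L ∧ ¬ patch y} : Set E3).ncard : ℝ)
        - C * (L + 1) ^ 2 - θ * n ctr L ≤ exc ctr L := by
  obtain ⟨c₂, hc₂, hH2⟩ := H2
  refine ⟨c₂ / (2 * r / δ + 1) ^ 3, by positivity, fun θ hθ => ?_⟩
  obtain ⟨C₂, hC₂⟩ := hH2 θ hθ
  refine ⟨C₂ + c₂ * (24 * (r + δ) * (1 + δ) ^ 2 / δ ^ 3 + (2 * (r + δ) / δ) ^ 3) / (2 * r / δ + 1) ^ 3,
    fun ctr L => ?_⟩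
  have key := slack_transfer_explicit hδ hsep hr (exc := fun ctr L => exc ctr L + θ * n ctr L) H1 hc₂
    (C₂ := C₂) (fun ctr L => by have := hC₂ ctr L; linarith) ctr L
  linarith

/-! ## The slack is a volume term -/

/-- `#(X ∩ B̄_L(ctr)) ≤ (2/δ + 1)³ (L + 1)³` for a `δ`-separated `X` and `L ≥ 0` (packing, `ncard_ball_le`).
[folklore] -/
theorem ncard_ball_le_cube {δ : ℝ} (hδ : 0 < δ) {X : Set E3}
    (hsep : ∀ y ∈ X, ∀ z ∈ X, y ≠ z → δ ≤ dist y z) (ctr : E3) {L : ℝ} (hL : 0 ≤ L) :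
    (({y : E3 | y ∈ X ∧ dist y ctr ≤ L} : Set E3).ncard : ℝ) ≤ (2 / δ + 1) ^ 3 * (L + 1) ^ 3 := by
  have h := ncard_ball_le hδ hsep ctr hL
  have h1 : 2 * L / δ + 1 ≤ (2 / δ + 1) * (L + 1) := by
    have hδ' : 0 < δ⁻¹ := inv_pos.2 hδ
    rw [div_eq_mul_inv, div_eq_mul_inv]
    nlinarith
  have h0 : 0 ≤ 2 * L / δ + 1 := by positivity
  calc (({y : E3 | y ∈ X ∧ dist y ctr ≤ L} : Set E3).ncard : ℝ) ≤ (2 * L / δ + 1) ^ 3 := h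
    _ ≤ ((2 / δ + 1) * (L + 1)) ^ 3 := pow_le_pow_left₀ h0 h1 3
    _ = (2 / δ + 1) ^ 3 * (L + 1) ^ 3 := by ring

/-! ## Density from a price with slack -/

/-- **Density from price with slack** (real bookkeeping): a price `c·D − C(L+1)² − θ₁·n ≤ T − 2e·n` of shape
`∃ c > 0 ∀ θ₁ > 0 ∃ C`, a bulk bound `T ≤ 2ℓ·n + εL³` for `L ≥ L₀(ε)` (every `ε > 0`), `ℓ ≤ e`, `0 ≤ n ≤ K(L+1)³`
for `L ≥ 0` give `∀ θ > 0 ∃ L₀ ∀ L ≥ L₀ ∀ ctr, D(ctr, L) ≤ θ L³` (choose `θ₁ := cθ/(32(K+1))`, `ε := cθ/4`).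
[folklore] -/
theorem density_of_priceSlack {V : Type*} (D n T : V → ℝ → ℝ) (e ℓ K : ℝ)
    (hn : ∀ ctr L, 0 ≤ n ctr L) (hnK : ∀ ctr L, 0 ≤ L → n ctr L ≤ K * (L + 1) ^ 3) (hK : 0 ≤ K)
    (hℓ : ℓ ≤ e)
    (hprice : ∃ c : ℝ, 0 < c ∧ ∀ θ₁ : ℝ, 0 < θ₁ → ∃ C : ℝ, ∀ ctr L,
      c * D ctr L - C * (L + 1) ^ 2 - θ₁ * n ctr L ≤ T ctr L - 2 * e * n ctr L)
    (hbulk : ∀ ε : ℝ, 0 < ε → ∃ L₀ : ℝ, ∀ L : ℝ, L₀ ≤ L → ∀ ctr, T ctr L ≤ 2 * ℓ * n ctr L + ε * L ^ 3) :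
    ∀ θ : ℝ, 0 < θ → ∃ L₀ : ℝ, ∀ L : ℝ, L₀ ≤ L → ∀ ctr, D ctr L ≤ θ * L ^ 3 := by
  intro θ hθ
  obtain ⟨c, hc, hcθ⟩ := hprice
  obtain ⟨C, hC⟩ := hcθ (c * θ / (32 * (K + 1))) (by positivity)
  obtain ⟨L₁, hL₁⟩ := hbulk (c * θ / 4) (by positivity)
  refine ⟨max L₁ (max 1 (8 * max C 0 / (c * θ))), fun L hL ctr => ?_⟩
  have hL₁L : L₁ ≤ L := le_trans (le_max_left _ _) hL
  have h1L : 1 ≤ L := le_trans (le_trans (le_max_left _ _) (le_max_right _ _)) hL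
  have hCL : 8 * max C 0 / (c * θ) ≤ L := le_trans (le_trans (le_max_right _ _) (le_max_right _ _)) hL
  have hL0 : 0 ≤ L := le_trans zero_le_one h1L
  have hp := hC ctr L
  have hb := hL₁ L hL₁L ctr
  have hnL := hnK ctr L hL0
  have hn0 := hn ctr L
  have hcθ : 0 < c * θ := mul_pos hc hθ
  -- `c D ≤ ε L³ + θ₁ n + C (L+1)² + 2(ℓ - e) n ≤ …`
  have hmain : c * D ctr L ≤ c * θ / 4 * L ^ 3 + c * θ / (32 * (K + 1)) * (K * (L + 1) ^ 3)
      + max C 0 * (L + 1) ^ 2 := by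
    have h2 : 2 * ℓ * n ctr L ≤ 2 * e * n ctr L := by nlinarith
    have h3 : C * (L + 1) ^ 2 ≤ max C 0 * (L + 1) ^ 2 :=
      mul_le_mul_of_nonneg_right (le_max_left _ _) (sq_nonneg _)
    have h4 : c * θ / (32 * (K + 1)) * n ctr L ≤ c * θ / (32 * (K + 1)) * (K * (L + 1) ^ 3) :=
      mul_le_mul_of_nonneg_left hnL (by positivity)
    linarith
  -- `(L+1)³ ≤ 8 L³`, `(L+1)² ≤ 4 L²`, `K/(K+1) ≤ 1`
  have h2L : L + 1 ≤ 2 * L := by linarith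
  have hL10 : 0 ≤ L + 1 := by linarith
  have h5 : (L + 1) ^ 3 ≤ 8 * L ^ 3 := by
    calc (L + 1) ^ 3 ≤ (2 * L) ^ 3 := pow_le_pow_left₀ hL10 h2L 3
      _ = 8 * L ^ 3 := by ring
  have h6 : (L + 1) ^ 2 ≤ 4 * L ^ 2 := by
    calc (L + 1) ^ 2 ≤ (2 * L) ^ 2 := pow_le_pow_left₀ hL10 h2L 2
      _ = 4 * L ^ 2 := by ring
  have h7 : c * θ / (32 * (K + 1)) * (K * (L + 1) ^ 3) ≤ c * θ / 4 * L ^ 3 := by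
    have hK1 : 0 < K + 1 := by linarith
    have hA : c * θ / (32 * (K + 1)) * K ≤ c * θ / 32 := by
      rw [div_mul_eq_mul_div, div_le_iff₀ (by positivity)]
      nlinarith
    have hB : 0 ≤ c * θ / (32 * (K + 1)) * K := by positivity
    calc c * θ / (32 * (K + 1)) * (K * (L + 1) ^ 3) = (c * θ / (32 * (K + 1)) * K) * (L + 1) ^ 3 := by ring
      _ ≤ (c * θ / 32) * (8 * L ^ 3) := mul_le_mul hA h5 (by positivity) (by positivity)
      _ = c * θ / 4 * L ^ 3 := by ring
  have h8 : max C 0 * (L + 1) ^ 2 ≤ c * θ / 2 * L ^ 3 := by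
    have hM0 : 0 ≤ max C 0 := le_max_right _ _
    have h9 : 8 * max C 0 ≤ c * θ * L := by
      have := (div_le_iff₀ hcθ).mp hCL
      linarith
    have h10 : max C 0 * (L + 1) ^ 2 ≤ max C 0 * (4 * L ^ 2) := mul_le_mul_of_nonneg_left h6 hM0
    have h11 : max C 0 * (4 * L ^ 2) ≤ c * θ / 2 * L ^ 3 := by
      have h12 : 8 * max C 0 * L ^ 2 ≤ c * θ * L * L ^ 2 := mul_le_mul_of_nonneg_right h9 (sq_nonneg L)
      nlinarith [mul_nonneg hM0 (sq_nonneg L)]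
    linarith
  have h13 : c * D ctr L ≤ c * (θ * L ^ 3) := by nlinarith
  exact le_of_mul_le_mul_left h13 hc

end Summit.AtomisticToContinuum.Crystallization.Theorems.DisclinationRationBarlowLiouville

end
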